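import Literature.Probability.RandomPlanarGeometry.HexSAWBrickWallStripFugacityWidthOneComplexFugacity
import Literature.Probability.RandomPlanarGeometry.HexSAWBrickWallStripFugacityWidthOneSeries
import Mathlib.Algebra.MvPolynomial.Funext
import HarnessLib

/-!
# The rational two-wall strip series over ANY commutative ring: `(Σ_N C_{1,N}(w,v)X^N)·[(1 − wX²)(1 − vX²) − wvX⁶]·(1 − wvX⁴)² = P(X; w, v)`

Topic `Literature/Probability/RandomPlanarGeometry` (continues `…WidthOneSeries.lean` — ★★★ `stripZ₂_one_series`: the identity above for REAL fugacities
`y, z`, proved from the weighted counting automaton over `ℝ⟦X⟧` — and `…WidthOneComplexFugacity.lean` — `stripZ₂C`, the two-fugacity polynomial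
`C_{T,N}` with fugacities in any commutative semiring, and the characteristic function of the contact law as its value at the COMPLEX fugacity
`y e^{it/√N}`).  The Berry–Esseen / local-limit programme needs the rational series, hence the order-14 coefficient recurrence and the partial-fraction
machinery, at COMPLEX fugacities.  THIS FILE transfers the real identity to every commutative ring WITHOUT re-running the automaton, by polynomial
extensionality: both sides have `X`-coefficients that are integer polynomials in the two fugacities, and an integer polynomial in two variables that
vanishes at all integer points is zero (`MvPolynomial.funext` over `ℤ`).

* §1 `twoWallPC w v`, `twoWallDC w v` — the numerator `P` and the denominator `[(1 − wX²)(1 − vX²) − wvX⁶](1 − wvX⁴)²` with coefficients in any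
  commutative ring (`twoWallPC_real : twoWallPC y z = twoWallP y z` is `rfl`); `map` lemmas for ring homomorphisms (`map_twoWallPC`, `map_twoWallDC`,
  `map_stripZ₂C`, `map_mk_stripZ₂C`).
* §2 ★ `stripZ₂C_one_series_univ` — the identity in `(MvPolynomial (Fin 2) ℤ)⟦X⟧` at the universal fugacities `X 0, X 1` (evaluate at integer points,
  cast to `ℝ`, use `stripZ₂_one_series`, `MvPolynomial.funext`).
* §3 ★★ `stripZ₂C_one_series` — the identity in `S⟦X⟧` for EVERY commutative ring `S` and all `w, v ∈ S` (base change of §2); in particular at complex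
  fugacities (`S = ℂ`), the input of the complex two-term asymptotics (`Literature/Analysis/Asymptotics/ComplexLinearRecurrenceDominantRoot.lean`).

## Sources
N. R. Beaton, M. Bousquet-Mélou, J. de Gier, H. Duminil-Copin, A. J. Guttmann, CMP 326 (2014), arXiv:1109.0358v5 §3.2 (p. 12: the strip series are rational;
p. 10: `C_{T,N}(y,z)`); R. P. Stanley, *Enumerative Combinatorics* 1 (2nd ed.) §4.1 Theorem 4.1.1, §4.7 Theorem 4.7.2.  The base-change argument is
lane plumbing (lane «pcv-sawmu», a-p5 g27); nothing is quoted AS PRINTED.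
-/

noncomputable section

open Finset PowerSeries

namespace Literature.Probability.RandomPlanarGeometry.SAW.HexBW

namespace WidthOneYZ

/-! ## §1 Numerator and denominator with coefficients in any commutative ring -/

/-- **The numerator `P(X; w, v)` of the two-wall strip series with fugacities in a commutative ring** (the tree's `twoWallP` is the case `R = ℝ`,
definitionally: `twoWallPC_real`). [cite: BeatonBousquetMelouDeGierDuminilCopinGuttmann2014, §3.2 (arXiv v5 p. 12: the strip series are rational)] -/
def twoWallPC {R : Type*} [CommRing R] (w v : R) : R⟦X⟧ :=
  ((2 + C v + C w) + (2 + 4 * C v + 4 * C w) * X + (4 * C v + C v ^ 2 + 4 * C w - 2 * C w * C v + C w ^ 2) * X ^ 2 + (2 * C v + 2 * C w) * X ^ 3 + (2 * C v + 2 * C w + 2 * C w * C v - 3 * C w * C v ^ 2 - 3 * C w ^ 2 * C v) * X ^ 4 + (14 * C w * C v - 8 * C w * C v ^ 2 - 8 * C w ^ 2 * C v) * X ^ 5 + (2 * C w * C v - 3 * C w * C v ^ 2 - 2 * C w * C v ^ 3 - 3 * C w ^ 2 * C v + 4 * C w ^ 2 * C v ^ 2 - 2 * C w ^ 3 * C v)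 * X ^ 6 + (2 * C w * C v - 4 * C w * C v ^ 2 - 4 * C w ^ 2 * C v) * X ^ 7 + (4 * C w * C v ^ 2 + 4 * C w ^ 2 * C v - 6 * C w ^ 2 * C v ^ 2 + 3 * C w ^ 2 * C v ^ 3 + 3 * C w ^ 3 * C v ^ 2) * X ^ 8 + (-2 * C w ^ 2 * C v ^ 2 + 4 * C w ^ 2 * C v ^ 3 + 4 * C w ^ 3 * C v ^ 2) * X ^ 9 + (-4 * C w ^ 2 * C v ^ 2 - 4 * C w ^ 2 * C v ^ 3 + C w ^ 2 * C v ^ 4 - 4 * C w ^ 3 * C v ^ 2 - 2 * C w ^ 3 * C v ^ 3 + C w ^ 4 * C v ^ 2) * X ^ 10 + (-2 * C w ^ 2 * C v ^ 3 - 2 * C w ^ 3 * C v ^ 2) * X ^ 11 + (2 * C w ^ 2 * C v ^ 3 + 2 * C w ^ 3 * C v ^ 2 + 6 * C w ^ 3 * C v ^ 3 - (C w ^ 3 * C v ^ 4) - (C w ^ 4 * C v ^ 3)) * X ^ 12 + (-2 * C w ^ 3 * C v ^ 3) * X ^ 13 + (-2 * C w ^ 3 * C v ^ 3 + C w ^ 3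 * C v ^ 4 + C w ^ 4 * C v ^ 3) * X ^ 14 + (2 * C w ^ 3 * C v ^ 3) * X ^ 15)

/-- **The denominator `[(1 − wX²)(1 − vX²) − wvX⁶]·(1 − wvX⁴)²` with fugacities in a commutative ring.**
[cite: BeatonBousquetMelouDeGierDuminilCopinGuttmann2014, §3.2 (arXiv v5 p. 12); Stanley2012EC1, §4.1 Theorem 4.1.1] -/
def twoWallDC {R : Type*} [CommRing R] (w v : R) : R⟦X⟧ :=
  ((1 - C w * X ^ 2) * (1 - C v * X ^ 2) - C w * C v * X ^ 6) * (1 - C w * C v * X ^ 4) ^ 2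

/-- On `ℝ` the generic numerator IS the tree's `twoWallP`. [cite: BeatonBousquetMelouDeGierDuminilCopinGuttmann2014, §3.2 (lane plumbing)] -/
theorem twoWallPC_real (y z : ℝ) : twoWallPC y z = twoWallP y z := rfl

section Map

variable {R S : Type*} [CommRing R] [CommRing S] (f : R →+* S)

/-- Ring homomorphisms act on the fugacities of the numerator. [cite: Stanley2012EC1, §4.1 (lane plumbing: base change)] -/
theorem map_twoWallPC (w v : R) : PowerSeries.map f (twoWallPC w v) = twoWallPC (f w) (f v) := by
  simp only [twoWallPC, map_add, map_sub, map_mul, map_pow, map_neg, PowerSeries.map_C, PowerSeries.map_X, map_ofNat]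

/-- Ring homomorphisms act on the fugacities of the denominator. [cite: Stanley2012EC1, §4.1 (lane plumbing: base change)] -/
theorem map_twoWallDC (w v : R) : PowerSeries.map f (twoWallDC w v) = twoWallDC (f w) (f v) := by
  simp only [twoWallDC, map_sub, map_mul, map_pow, PowerSeries.map_C, PowerSeries.map_X, map_one]

/-- Ring homomorphisms act on the fugacities of `C_{T,n}`. [cite: BeatonBousquetMelouDeGierDuminilCopinGuttmann2014, §3.2 (lane plumbing: base change)] -/
theorem map_stripZ₂C (T n : ℕ) (w v : R) : f (stripZ₂C T n w v) = stripZ₂C T n (f w) (f v) := by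
  unfold stripZ₂C
  rw [map_sum]
  refine Finset.sum_congr rfl fun p _ => ?_
  rw [map_mul, map_pow, map_pow]

/-- Ring homomorphisms act on the fugacities of the series `Σ_N C_{T,N} X^N`. [cite: BeatonBousquetMelouDeGierDuminilCopinGuttmann2014, §3.2 (lane plumbing)] -/
theorem map_mk_stripZ₂C (T : ℕ) (w v : R) :
    PowerSeries.map f (PowerSeries.mk fun n => stripZ₂C T n w v) = PowerSeries.mk fun n => stripZ₂C T n (f w) (f v) := by
  ext n
  rw [PowerSeries.coeff_map, coeff_mk, coeff_mk, map_stripZ₂C]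

end Map

/-! ## §2 ★ The identity at the universal fugacities -/

/-- ★ **The series identity in `(ℤ[W,V])⟦X⟧` at the universal fugacities `W = X 0`, `V = X 1`**: both sides have integer-polynomial coefficients, and
their difference vanishes at every integer point `(a, b)` — indeed at every real point, by the tree's `stripZ₂_one_series` — so it is zero
(`MvPolynomial.funext`). [cite: BeatonBousquetMelouDeGierDuminilCopinGuttmann2014, §3.2 (arXiv v5 p. 12); Stanley2012EC1, §4.1 Theorem 4.1.1 (lane plumbing: polynomial extensionality)] -/
theorem stripZ₂C_one_series_univ :
    (PowerSeries.mk fun N => stripZ₂C 1 N (MvPolynomial.X 0 : MvPolynomial (Fin 2) ℤ) (MvPolynomial.X 1))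
        * twoWallDC (MvPolynomial.X 0 : MvPolynomial (Fin 2) ℤ) (MvPolynomial.X 1)
      = twoWallPC (MvPolynomial.X 0 : MvPolynomial (Fin 2) ℤ) (MvPolynomial.X 1) := by
  refine PowerSeries.ext fun N => ?_
  apply MvPolynomial.funext
  intro x
  -- cast the integer evaluation to `ℝ`
  apply Int.cast_injective (α := ℝ)
  set φ : MvPolynomial (Fin 2) ℤ →+* ℝ := MvPolynomial.eval₂Hom (Int.castRingHom ℝ) (fun i => (x i : ℝ)) with hφ
  have hcomp : (Int.castRingHom ℝ).comp (MvPolynomial.eval x) = φ := by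
    refine MvPolynomial.ringHom_ext (fun r => ?_) (fun i => ?_)
    · simp [hφ]
    · simp [hφ]
  have hcast : ∀ p : MvPolynomial (Fin 2) ℤ, ((MvPolynomial.eval x p : ℤ) : ℝ) = φ p := fun p => by
    have := congrArg (fun g : MvPolynomial (Fin 2) ℤ →+* ℝ => g p) hcomp
    simpa using this
  show ((MvPolynomial.eval x _ : ℤ) : ℝ) = ((MvPolynomial.eval x _ : ℤ) : ℝ)
  rw [hcast, hcast, ← PowerSeries.coeff_map, ← PowerSeries.coeff_map, map_mul, map_mk_stripZ₂C, map_twoWallDC, map_twoWallPC]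
  have hW : φ (MvPolynomial.X 0) = (x 0 : ℝ) := by simp [hφ]
  have hV : φ (MvPolynomial.X 1) = (x 1 : ℝ) := by simp [hφ]
  rw [hW, hV]
  -- the real identity of the tree
  have hreal := stripZ₂_one_series (x 0 : ℝ) (x 1 : ℝ)
  have e1 : (PowerSeries.mk fun n => stripZ₂C 1 n ((x 0 : ℤ) : ℝ) ((x 1 : ℤ) : ℝ)) = PowerSeries.mk fun N => stripZ₂ 1 N (x 0 : ℝ) (x 1 : ℝ) := by
    ext n; rw [coeff_mk, coeff_mk, stripZ₂C_real]
  have e2 : twoWallDC ((x 0 : ℤ) : ℝ) ((x 1 : ℤ) : ℝ)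
      = ((1 - C ((x 0 : ℤ) : ℝ) * X ^ 2) * (1 - C ((x 1 : ℤ) : ℝ) * X ^ 2) - C ((x 0 : ℤ) : ℝ) * C ((x 1 : ℤ) : ℝ) * X ^ 6)
        * (1 - C ((x 0 : ℤ) : ℝ) * C ((x 1 : ℤ) : ℝ) * X ^ 4) ^ 2 := rfl
  rw [e1, e2, twoWallPC_real, hreal]

/-! ## §3 ★★ The identity over every commutative ring (complex fugacities included) -/

/-- ★★ **THE RATIONAL TWO-WALL STRIP SERIES OVER ANY COMMUTATIVE RING**: for every commutative ring `S` and all `w, v ∈ S`,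
`(Σ_N C_{1,N}(w, v) X^N) · [(1 − wX²)(1 − vX²) − wvX⁶] · (1 − wvX⁴)² = P(X; w, v)` in `S⟦X⟧` — in particular at COMPLEX fugacities, where it is the
starting point of the complex two-term asymptotics of `C_{1,N}(y e^{iθ/√N}, z)` (Berry–Esseen rate / local limit theorem for the contact number).
Base change of `stripZ₂C_one_series_univ` along `ℤ[W,V] → S`, `W ↦ w`, `V ↦ v`. [cite: BeatonBousquetMelouDeGierDuminilCopinGuttmann2014, §3.2 (arXiv v5 p. 12: the strip series are rational); Stanley2012EC1, §4.7 Theorem 4.7.2] -/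
theorem stripZ₂C_one_series {S : Type*} [CommRing S] (w v : S) :
    (PowerSeries.mk fun N => stripZ₂C 1 N w v) * twoWallDC w v = twoWallPC w v := by
  set ψ : MvPolynomial (Fin 2) ℤ →+* S := MvPolynomial.eval₂Hom (Int.castRingHom S) (fun i => if i = 0 then w else v) with hψ
  have hW : ψ (MvPolynomial.X 0) = w := by simp [hψ]
  have hV : ψ (MvPolynomial.X 1) = v := by simp [hψ]
  have h := congrArg (PowerSeries.map ψ) stripZ₂C_one_series_univ
  rw [map_mul, map_mk_stripZ₂C, map_twoWallDC, map_twoWallPC, hW, hV] at h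
  exact h

/-- **The complex case, spelled out**: for all `w, v ∈ ℂ`,
`(Σ_N C_{1,N}(w,v) X^N)·[(1 − wX²)(1 − vX²) − wvX⁶]·(1 − wvX⁴)² = P(X; w, v)` in `ℂ⟦X⟧`.
[cite: BeatonBousquetMelouDeGierDuminilCopinGuttmann2014, §3.2 (arXiv v5 p. 12); Stanley2012EC1, §4.7 Theorem 4.7.2] -/
theorem stripZ₂C_one_series_complex (w v : ℂ) :
    (PowerSeries.mk fun N => stripZ₂C 1 N w v)
        * (((1 - C w * X ^ 2) * (1 - C v * X ^ 2) - C w * C v * X ^ 6) * (1 - C w * C v * X ^ 4) ^ 2) = twoWallPC w v :=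
  stripZ₂C_one_series w v

end WidthOneYZ

end Literature.Probability.RandomPlanarGeometry.SAW.HexBW

end
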